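import Literature.AlgebraicGeometry.HodgeTheory.HodgeSectionRestrictionTriangulable
import Literature.ModelTheory.ExponentialFields.SemialgebraicTriangulationTheorem
import HarnessLib

/-!
# Complex projective algebraic sets are locally contractible — unconditionally, from the proved
# semialgebraic triangulation theorem

Family `hodge`, layer `Literature/AlgebraicGeometry/HodgeTheory`. The tree's
`locallyContractibleSpace_complexPoints_of_c1Triangulation` (`HodgeSectionRestrictionTriangulable`:
complex algebraic sets are triangulable, hence locally contractible — Łojasiewicz 1964; Hatcher
App. Prop. A.4) derives the local contractibility of `Z(ℂ) = {P ∈ X(ℂ) | pt P ∈ Z}`, `Z` Zariski-closed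
in a `ℂ`-scheme `X` with a projective embedding, from the named fact `OhmotoShiota2017_c1Triangulation`
(Ohmoto–Shiota 2017, Thm. 1.1: `C¹` triangulations). Only the TOPOLOGICAL triangulation is used there
(the `C¹` realisation is discarded), and the topological semialgebraic triangulation theorem
(Ohmoto–Shiota Thm. 2.2 = Łojasiewicz; van den Dries Ch. 8 (2.9); BCR Thm. 9.2.1) is now PROVED in the
tree (`Literature.ModelTheory.ExponentialFields.semialgebraic_triangulation`,
`SemialgebraicTriangulationTheorem.lean`). This file re-runs the last link of that chain with the
proved theorem, making (LC) unconditional: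

* `locallyContractibleSpace_complexPoints` — `Z(ℂ)` is locally contractible for every Zariski-closed
  `Z` of a `ℂ`-scheme with a projective embedding (`Z(ℂ) ≃ₜ V(S) ≃ₜ Φ(V(S)) ≃ₜ |K|`,
  `EmbPoints.exists_homeomorph_projZeroLocus`, `ProjSemialg.projZeroLocusHomeomorph`,
  `semialgebraic_triangulation`, `Polyhedron.locallyContractibleSpace_space`);
* `locallyContractibleSpace_complexPoints_of_isSmoothProjective` — the same in the binder shape
  consumed by `HodgeSectionRestrictionProofs` and by the weak Lefschetz theorem in affine-cover form
  (`Summits/HodgeConjecture/…/AmpleAdicLefschetzWeakLefschetzInjective`);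
* `locallyContractibleSpace_complexPoints_self` (`_of_isProjectiveOver`, `_of_isSmoothProjective`) —
  the case `Z = X`: `X(ℂ)` itself is locally contractible for `X` projective (the hypothesis shape of
  the finite-quotient transfer `bredon1997_quotient_cohomology_invariants`, consumed by
  `Motives/FiniteQuotient`);
* `exists_isOpen_map_eq_zero_of_isClosed` — tautness of `Z(ℂ)` in `X(ℂ)` for `X` smooth projective:
  a class vanishing on `Z(ℂ)` vanishes on an open neighbourhood (the tree's
  `exists_isOpen_map_eq_zero_of_locallyContractibleSpace`).

Everything here is proved; no definitions, no named facts.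

## References

* [OhmotoShiota2017] T. Ohmoto, M. Shiota, C¹-triangulations of semialgebraic sets, J. Topology 10
  (2017), Thm. 2.2 (Łojasiewicz's semialgebraic triangulation).
* [BochnakCosteRoy1998] J. Bochnak, M. Coste, M.-F. Roy, Real Algebraic Geometry (1998), Thm. 9.2.1.
* [HatcherAT2002] A. Hatcher, Algebraic Topology (2002), Appendix, Prop. A.4 (CW complexes are
  locally contractible).
* [Spanier1981] E. H. Spanier, Algebraic Topology, Ch. 6 §1, Thm. 10 and Cor. 11 (tautness).
-/

noncomputable section

open Set Filter
open CategoryTheory AlgebraicGeometry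
open Literature.AlgebraicTopology.SingularHomology Literature.AlgebraicTopology.Homotopy
open Literature.ModelTheory.ExponentialFields Literature.NumberTheory.Transcendental

namespace Literature.AlgebraicGeometry.HodgeTheory

variable {X : Motives.SchemeOver ℂ}

/-- **Complex projective algebraic sets are locally contractible** (unconditional): the complex
points `Z(ℂ) = {P ∈ X(ℂ) | pt P ∈ Z}` of every Zariski-closed subset `Z` of a `ℂ`-scheme `X` with a
projective embedding form a locally contractible space. `Z(ℂ) ≃ₜ V(S)` for finitely many forms `S`
(`EmbPoints.exists_homeomorph_projZeroLocus`), `V(S) ≃ₜ Φ(V(S))` its compact semialgebraic model in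
Hermitian coordinates (`ProjSemialg.projZeroLocusHomeomorph`, `isSemialgebraic_image_projEmb`),
`Φ(V(S)) ≃ₜ |K|` for a finite simplicial complex `K` by the PROVED semialgebraic triangulation theorem
(`semialgebraic_triangulation`, Ohmoto–Shiota Thm. 2.2 / Łojasiewicz), and `|K|` is locally
contractible (`Polyhedron.locallyContractibleSpace_space`). [cite: OhmotoShiota2017, Thm. 2.2]
[cite: HatcherAT2002, App. Prop. A.4] -/
theorem locallyContractibleSpace_complexPoints (e : Motives.ProjectiveEmbedding X)
    {Z : Set X.left} (hZ : IsClosed Z) :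
    LocallyContractibleSpace {P : Motives.ComplexPoints X // P.pt ∈ Z} := by
  obtain ⟨S, hS, ⟨φ₁⟩⟩ := EmbPoints.exists_homeomorph_projZeroLocus e hZ
  obtain ⟨K, Φ, Ψ, hK, hΦΨ, -⟩ := semialgebraic_triangulation _ _
    (ProjSemialg.isSemialgebraic_image_projEmb S hS) (ProjSemialg.isCompact_image_projEmb S hS) ∅
    (by simp)
  exact locallyContractibleSpace_of_homeomorph
    (φ₁.trans ((ProjSemialg.projZeroLocusHomeomorph S).trans hΦΨ.toHomeomorph)).symm
    (Polyhedron.locallyContractibleSpace_space hK)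

/-- (LC) in the shape consumed by `HodgeSectionRestrictionProofs` and by the weak Lefschetz theorem in
affine-cover form: for every smooth projective complex variety `X` and every Zariski-closed `Z`,
`Z(ℂ)` is locally contractible — unconditionally. [cite: OhmotoShiota2017, Thm. 2.2]
[cite: HatcherAT2002, App. Prop. A.4] -/
theorem locallyContractibleSpace_complexPoints_of_isSmoothProjective :
    ∀ ⦃n : ℕ⦄ ⦃X : Motives.SchemeOver ℂ⦄, Motives.IsSmoothProjective n X →
      ∀ Z : Set X.left, IsClosed Z →
        LocallyContractibleSpace {P : Motives.ComplexPoints X // P.pt ∈ Z} :=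
  fun _ _ hX _ hZ ↦ locallyContractibleSpace_complexPoints hX.isProjectiveOver.projectiveEmbedding hZ

/-- **Tautness of `Z(ℂ)` in `X(ℂ)`** (unconditional): for `X` smooth projective and `Z ⊆ X`
Zariski-closed, a class `c ∈ Hᵏ(X(ℂ); ℂ)` vanishing on `Z(ℂ)` vanishes on some open neighbourhood of
`Z(ℂ)` (`exists_isOpen_map_eq_zero_of_locallyContractibleSpace` with (LC) supplied by
`locallyContractibleSpace_complexPoints`). [cite: Spanier1981, Ch. 6 §1, Thm. 10 and Cor. 11]
[cite: OhmotoShiota2017, Thm. 2.2] -/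
theorem exists_isOpen_map_eq_zero_of_isClosed {m : ℕ} (hX : Motives.IsSmoothProjective m X)
    {Z : Set X.left} (hZ : IsClosed Z) {k : ℕ} (c : complexBetti X k)
    (hc : singularCohomology.map ℂ ℂ
      (⟨Subtype.val, continuous_subtype_val⟩ :
        C({P : Motives.ComplexPoints X // P.pt ∈ Z}, Motives.ComplexPoints X)) k c = 0) :
    ∃ V : Set (Motives.ComplexPoints X), IsOpen V ∧
      (∀ P : Motives.ComplexPoints X, P.pt ∈ Z → P ∈ V) ∧
      singularCohomology.map ℂ ℂ (subsetIncl V) k c = 0 :=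
  exists_isOpen_map_eq_zero_of_locallyContractibleSpace hX hZ
    (locallyContractibleSpace_complexPoints hX.isProjectiveOver.projectiveEmbedding hZ) c hc

/-! ### The whole space: `X(ℂ)` is locally contractible for `X` projective -/

/-- **The complex points of a projective `ℂ`-scheme form a locally contractible space**: the case
`Z = X` of `locallyContractibleSpace_complexPoints` (`X(ℂ) ≃ₜ {P ∈ X(ℂ) | pt P ∈ X} ≃ₜ |K|` for a
finite simplicial complex `K`, by the proved semialgebraic triangulation theorem; finite polyhedra
are locally contractible). This is the hypothesis shape of the finite-quotient transfer
(`bredon1997_quotient_cohomology_invariants`: compact Hausdorff LOCALLY CONTRACTIBLE spaces).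
[cite: OhmotoShiota2017, Thm. 2.2] [cite: HatcherAT2002, App. Prop. A.4] -/
theorem locallyContractibleSpace_complexPoints_self (e : Motives.ProjectiveEmbedding X) :
    LocallyContractibleSpace (Motives.ComplexPoints X) := by
  have h := locallyContractibleSpace_complexPoints e isClosed_univ
  let φ : {P : Motives.ComplexPoints X // P.pt ∈ (Set.univ : Set X.left)} ≃ₜ
      Motives.ComplexPoints X :=
    { toFun := Subtype.val
      invFun := fun P => ⟨P, Set.mem_univ _⟩
      left_inv := fun _ => rfl
      right_inv := fun _ => rfl
      continuous_toFun := continuous_subtype_val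
      continuous_invFun := continuous_id.subtype_mk _ }
  exact locallyContractibleSpace_of_homeomorph φ h

/-- `X(ℂ)` is locally contractible for `X` projective over `ℂ` (`IsProjectiveOver`, through its
projective embedding). [cite: OhmotoShiota2017, Thm. 2.2] [cite: HatcherAT2002, App. Prop. A.4] -/
theorem locallyContractibleSpace_complexPoints_self_of_isProjectiveOver
    (hX : Motives.IsProjectiveOver X) : LocallyContractibleSpace (Motives.ComplexPoints X) :=
  locallyContractibleSpace_complexPoints_self hX.projectiveEmbedding

/-- `X(ℂ)` is locally contractible for `X` smooth projective over `ℂ`.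
[cite: OhmotoShiota2017, Thm. 2.2] [cite: HatcherAT2002, App. Prop. A.4] -/
theorem locallyContractibleSpace_complexPoints_self_of_isSmoothProjective {n : ℕ}
    (hX : Motives.IsSmoothProjective n X) : LocallyContractibleSpace (Motives.ComplexPoints X) :=
  locallyContractibleSpace_complexPoints_self hX.isProjectiveOver.projectiveEmbedding

end Literature.AlgebraicGeometry.HodgeTheory
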